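import Summits.Ventures.WeilGRH.UniformConductorFloorCoprimeData
import HarnessLib

/-!
# GRH arm (rh-explicit, venture WeilGRH): the kernel check of the level-`3` joint cell certificate `certEvenDvd3`

Cell `rh-explicit`, WEIL TRACK — GRH ARM (weil-grh-1, gen7 «divisibility floors»).  `JointCert.checkFrame`, `checkOne` and
`checkCells` of the even pseudo-key certificate `certEvenDvd3` at level `m = 3` (`UniformConductorFloorCoprimeData.lean`), by
`decide +kernel`: integer arithmetic only (exact rational slab tables against `(319/320)^(a k)` via `Nat.pow`, the `320` cell
inequalities by the `O(J²)` zipper).  Consumed by `UniformConductorFloorCoprimeFloors.lean`.  No definitions; no named facts;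
standard axioms. [folklore]
-/

namespace Summit.Ventures.WeilGRH

namespace UniformFloor

set_option maxHeartbeats 0 in
set_option maxRecDepth 100000 in
/-- The frame of `certEvenDvd3` checks (shape, `φ` bounds, shifts, exact slab masses, exact constant, `e^{2t} ≤ 8`). [folklore] -/
theorem certEvenDvd3_checkFrame : certEvenDvd3.checkFrame = true := by
  decide +kernel

set_option maxHeartbeats 0 in
set_option maxRecDepth 100000 in
/-- The window of `certEvenDvd3` contains `[-1, 1]` (`e · (319/320)^320 ≤ 1`). [folklore] -/
theorem certEvenDvd3_checkOne : certEvenDvd3.checkOne = true := by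
  decide +kernel

set_option maxHeartbeats 0 in
set_option maxRecDepth 100000 in
/-- All `320` cell inequalities of `certEvenDvd3` (the zipper `JointCert.checkCells`; budget `RHO/D = 5.7260`, i.e. with
`Clow/D = 7.3210` the level-3 even floor `log q ≥ 3.7772`; kernel time ≈ 50 s). [folklore] -/
theorem certEvenDvd3_checkCells : certEvenDvd3.checkCells = true := by
  decide +kernel

end UniformFloor

end Summit.Ventures.WeilGRH
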